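import Literature.NumberTheory.ComplexMultiplication.TaniyamaElementAutomorphism
import Literature.NumberTheory.ComplexMultiplication.TaniyamaElementReflexNorm
import Literature.NumberTheory.ComplexMultiplication.CMFiniteIdeleHasseNorm
import Literature.NumberTheory.AdelicBaseChange.IdeleConormIdeals
import Literature.NumberTheory.QuadraticForms.GlobalSquareTheoremProofs
import HarnessLib

/-!
# The Taniyama element is determined up to a sequence of signs: Milne's Propositions 4.13, 4.14 and Corollary 4.15
# (Milne, *The fundamental theorem of complex multiplication*, arXiv:0705.3446, §4.3 «Proof of Theorem 4.2 up to a
# sequence of signs») — the number-theoretic half, for an axiomatised `g_Φ`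

Topic `NumberTheory/ComplexMultiplication`; namespace `Literature.NumberTheory.ComplexMultiplication`.  Lane
`lit-hodgefound` (Track 2, Layer A3 skeleton seat `skel-3`, row A3-G48; one file).  Rows A3-G45/46/47 put the whole of
§4.2 in the tree (`…/TateHalfTransferCM`: `F_Φ`; `…/TaniyamaElement`: `f_Φ`, Prop. 4.6, Prop. 4.8 (a), (c);
`…/TaniyamaElementAutomorphism`: Prop. 4.8 (b); `…/TaniyamaElementReflexNorm`: Prop. 4.9).  Two `Prop`-valued predicates
with bodies (`IsCMTypeCocycle`, `IsTaniyamaDefect`) and theorems, all proved; no named fact, no instance (D-0026, net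
debt 0).

## The print, verbatim

J. S. Milne, *The fundamental theorem of complex multiplication*, arXiv:0705.3446 [Milne2007FundamentalCM], §4.3 (held
`paper:arxiv-0705.3446` p0021 L37–L150, p0022 L1–L24):

> «PROPOSITION 4.12. The maps `g_Φ : Aut(ℂ) → 𝔸^×_{f,E}/E^×` have the following properties:
> (a) `g_Φ(στ) = g_{τΦ}(σ)·g_Φ(τ)`; (b) `g_{Φ(τ⁻¹|E)}(σ) = τ g_Φ(σ)` if `τE = E`; (c) `g_Φ(ι) = 1`;
> (d) `g_Φ(σ)·ι g_Φ(σ) = χ_cyc(σ)E^×`. […] Theorem 4.2 (hence also 4.1) becomes true if `f_Φ` is replaced by `g_Φ`. Our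
> task is to show that `f_Φ = g_Φ`. To this end we set `e_Φ(σ) = g_Φ(σ)/f_Φ(σ) ∈ 𝔸^×_{f,E}/E^×`. (45)
>
> PROPOSITION 4.13. The maps `e_Φ : Aut(ℂ) → 𝔸^×_{f,E}/E^×` have the following properties:
> (a) `e_Φ(στ) = e_{τΦ}(σ)·e_Φ(τ)`; (b) `e_{Φ(τ⁻¹|E)}(σ) = τ e_Φ(σ)` if `τE = E`; (c) `e_Φ(ι) = 1`;
> (d) `e_Φ(σ)·ι_E e_Φ(σ) = 1`; (e) `e_Φ(σ) = 1` if `σΦ = Φ`.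
> PROOF. Statements (a), (b), and (c) follow from (a), (b), and (c) of 4.8 and 4.12, and (d) follows from 4.6 (b) and
> 4.12 (d). The condition `σΦ = Φ` in (e) means that `σ` fixes the reflex field of `(E, Φ)` and, as we observed in the
> preceding subsection, the fundamental theorem is known to hold in that case, which means that `f_Φ(σ) = g_Φ(σ)`.
>
> PROPOSITION 4.14. Let `F` be the largest totally real subfield of `E`; then `e_Φ(σ) ∈ 𝔸^×_{f,F}/F^×` and `e_Φ(σ)² = 1`;
> moreover, `e_Φ(σ)` depends only on the effect of `σ` on `E*`, and is `1` if `σ|E* = id`.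
> PROOF. Recall that `σ` fixes `E*` if and only if `σΦ = Φ`, in which case (4.13e) shows that `e_Φ(σ) = 1`. Replacing
> `τ` by `σ⁻¹τ` in (a), we find that `e_Φ(τ) = e_Φ(σ)` if `τΦ = σΦ`, i.e., `e_Φ(σ)` depends only on the restriction of
> `σ` to the reflex field of `(E, Φ)`. From (b) with `τ = ι`, we find using `ιΦ = Φι_E` that `e_{ιΦ}(σ) = ι e_Φ(σ)`.
> Putting `τ = ι` in (a) and using (c) we find that `e_Φ(σι) = ι e_Φ(σ)`; putting `σ = ι` in (a) and using (c) we find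
> that `e_Φ(ισ) = e_Φ(σ)`. Since `ισ` and `σι` have the same effect on `E*`, we conclude `e_Φ(σ) = ι e_Φ(σ)`. Thus
> `e_Φ(σ) ∈ (𝔸^×_{f,E}/E^×)^{⟨ι_E⟩}`, which equals `𝔸^×_{f,F}/F^×` by Hilbert's Theorem 90. Finally, (d) shows that
> `e_Φ(σ)² = 1`.
>
> COROLLARY 4.15. Part (a) of 4.2 is true; part (b) of 4.2 becomes true when `f` is replaced by `ef` with
> `e ∈ 𝔸^×_{f,F}`, `e² = 1`.  PROOF. Let `e ∈ e_Φ(σ)`. Then `e² ∈ F^×` and, since an element of `F^×` that is a square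
> locally at all finite primes is a square ([CFT] VIII 1.1), we can correct `e` to achieve `e² = 1`.»

and §4.4, first display (p0022 L21–L24): «`e_Φ(σ) ∈ μ₂(𝔸_{f,F})/μ₂(F)`, `σ ∈ Aut(ℂ)`.»

## Setting (the tree's vocabulary, rows A3-G45 – A3-G47) and what is axiomatised

`K : Type` a CM field (Milne's `E`; `K⁺ = maximalRealSubfield K` is Milne's `F`), `c ∈ Γ_ℚ = absoluteGaloisGroup ℚ` a
complex conjugation, `X = Γ_ℚ ⧸ res(Γ_K) = Hom(K, ℚ̄)`, a CM type is `Ψ ⊆ X` with `IsCMTypeWith c Ψ` (then `Ψᶜ = c • Ψ` is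
Milne's `ιΦ = Φι_E`), `Q = (𝔸_{K,f})ˣ ⧸ K^×` with `ι_K = finiteClassConjGal K`, `χ(σ) = cyclotomicFiniteIdeleIn K σ`,
`f_Ψ = taniyamaElement K c Ψ` (`σ ∈ Γ_ℚ` instead of `Aut(ℂ)`, C. Blake, arXiv:1606.03320 §1 [Blake2016PlecticTaniyama]).
The geometric input of §4.3 — Lemma 4.10, Remark 4.11 and Proposition 4.12, i.e. the class `g_Φ(σ)` read off an
`E`-linear `H₁(A,ℚ) ≅ H₁(σA,ℚ)` — belongs to Layer B (abelian varieties); here `g` is ANY family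
`g : Set X → Γ_ℚ → Q` with the properties 4.12 (a), (b) at `τ = ι`, (c), (d) and agreeing with `f` on the stabilisers
`σ•Ψ = Ψ` (= 4.13 (e): the fundamental theorem over the reflex field, Thm. 3.10, with Prop. 4.9), and everything printed
after Prop. 4.12 is proved for it.

## What is formalised

* §1 `IsCMTypeCocycle K c u` — Milne's (a), (b) at `τ = ι` (`u Ψᶜ σ = ι_K (u Ψ σ)`), (c) for a family `u`; the new
  clause **`taniyamaElement_compl` (`f_{Ψᶜ}(σ) = ι_K f_Ψ(σ)`, Prop. 4.8 (b) at `τ = ι`)** by Prop. 4.6's uniqueness, and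
  `isCMTypeCocycle_taniyamaElement`; the dictionary `translateType c Ψ = Ψᶜ`, `finiteClassGal K ι_K = finiteClassConjGal K`
  with the printed (b) (row A3-G47's `translateType`, `finiteClassGal`).
* §2 `IsTaniyamaDefect K c e` — PROPOSITION 4.13 (a)–(e) as a predicate — and **the proof of Prop. 4.13**
  (`isTaniyamaDefect_div_taniyamaElement`): `e = g/f` satisfies it; the printed (b) for every `τE = E` passes from `g` to
  `e` (`div_taniyamaElement_translateType`).
* §3 **PROPOSITION 4.14 from the predicate alone, step by step as printed**: `eq_of_smul_set_eq` («`e_Φ(τ) = e_Φ(σ)` if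
  `τΦ = σΦ`»), `apply_mul_self` («`e_Φ(σι) = ι e_Φ(σ)`»), `apply_self_mul` («`e_Φ(ισ) = e_Φ(σ)`»), `smul_set_comm_of_isCMTypeWith`
  («`ισ` and `σι` have the same effect on `E*`»), `finiteClassConjGal_apply` («`e_Φ(σ) = ι e_Φ(σ)`»), `sq_eq_one`.
* §4 «which equals `𝔸^×_{f,F}/F^×` by Hilbert's Theorem 90»: a class of `Q` fixed by `ι_K` is `con(y)·K^×` for a finite
  idèle `y` of `K⁺` (`exists_eq_mk_finiteIdeleConorm_of_finiteClassConjGal_eq`; Hilbert 90 for `K/K⁺` written out, and the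
  `ι`-fixed part of `𝔸_{K,f} = con 𝔸_{K⁺,f} ⊕ α·con 𝔸_{K⁺,f}` — row A3-G43 FILE 2), hence `e_Ψ(σ) ∈ 𝔸^×_{f,F}/F^×`.
* §5 COROLLARY 4.15's number theory: a class `con(y)·K^×` of order `≤ 2` has a representative `ε` with `ε² = 1`
  («[CFT] VIII 1.1» = the tree's Global Square Theorem `QuadraticForms.globalSquareTheorem_holds`, O'Meara 65:15), so
  **`e_Ψ(σ) = con(ε)·K^×` with `ε ∈ (𝔸_{K⁺,f})ˣ`, `ε² = 1`, `ε_v = ±1`** — «`e_Φ(σ) ∈ μ₂(𝔸_{f,F})/μ₂(F)`».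

NOT HERE: Lemma 4.10, Remark 4.11, Proposition 4.12, Theorem 4.2 (abelian varieties — Layer B); §4.4 «Completion of the
proof» ((f), (g), the `ℓ₁, ℓ₂` argument, `e = 1`).

Lean note for users of the predicates: generic group lemmas on `𝔸^×_{K,f}/K^×` (`mul_one`, `mul_comm`, `div_mul_div_comm`,
…) are applied here with EXPLICIT arguments (`exact mul_one (e Ψ σ)`); with the argument left to unification (`rw [mul_one]`)
the `MulOneClass`/`CommMagma` instance problem on this quotient gets stuck (two instance paths, `QuotientGroup.Quotient.group`
and `QuotientGroup.Quotient.commGroup`, definitionally but not reducibly equal).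

## References

* J. S. Milne, *The fundamental theorem of complex multiplication*, arXiv:0705.3446 (2007), §4.3: Props. 4.12, 4.13,
  4.14, Cor. 4.15; §4.4 first display. [Milne2007FundamentalCM]
* C. Blake, *A plectic Taniyama group*, arXiv:1606.03320 (2016), §1. [Blake2016PlecticTaniyama]
* J. W. S. Cassels, *Global fields*, Ch. II of Cassels–Fröhlich, *Algebraic Number Theory* (1967), §14 (14.2), §19
  (19.2). [CasselsFrohlichANT1967]
* O. T. O'Meara, *Introduction to Quadratic Forms* (1963), §65C Thm. 65:15 (Global Square Theorem). [Omeara1963]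

## Provenance

Lane `lit-hodgefound`, seat `literature-prover-lit-hodgefound-skel-3-g32-0` (row A3-G48).
-/

noncomputable section

open scoped Pointwise
open Field NumberField IsDedekindDomain

namespace Literature.NumberTheory.ComplexMultiplication

open Literature.NumberTheory.GaloisRepresentations Literature.NumberTheory.NumberFields
open Literature.NumberTheory.AdelicBaseChange
open HalfTransfer

/-! ### §0. CM types: complements and translates (private copies, imports kept light) -/

section CMTypes

variable {G : Type*} [Group G] {X : Type*} [MulAction G X] {ι : G} {Φ : Set X}

/-- The complement of a CM type is a CM type (a copy of `IsCMTypeWith.compl` of `…/SerreGroupCMTypeGenerators`).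
[cite: Milne2007FundamentalCM, §4.1 («Hom(E,ℂ) = Φ ∪ ιΦ (disjoint union)»)] -/
private theorem cmType_compl (h : IsCMTypeWith ι Φ) : IsCMTypeWith ι Φᶜ where
  mem_iff x := by rw [Set.mem_compl_iff, Set.mem_compl_iff, not_not, h.rho_smul_mem_iff]
  comm := h.comm
  invol := h.invol

/-- A translate of a CM type is a CM type (a copy of `IsCMTypeWith.smul_set` of `…/ReflexDegreeQuadraticSubfieldBound`).
[cite: Milne2007FundamentalCM, §4.2 Lemma 4.4 (proof: «σ permutes the unordered pairs {φ, ιφ}»)] -/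
private theorem cmType_smul_set (h : IsCMTypeWith ι Φ) (g : G) : IsCMTypeWith ι (g • Φ) where
  mem_iff x := by
    rw [Set.mem_smul_set_iff_inv_smul_mem, Set.mem_smul_set_iff_inv_smul_mem, h.mem_iff, h.comm]
  comm := h.comm
  invol := h.invol

/-- **«`ισ` and `σι` have the same effect on `E*`»**: `(ισ)Φ = (σι)Φ` for a CM type `Φ` — the conjugation `ι` is central on
`X` (for `X = Hom(E, ℚ̄)`: every embedding of a CM field commutes with complex conjugation), so `ι(σΦ) = (σΦ)ᶜ = σ(Φᶜ) = σ(ιΦ)`.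
[cite: Milne2007FundamentalCM, §4.3 Prop. 4.14 (proof)] -/
theorem smul_set_comm_of_isCMTypeWith (h : IsCMTypeWith ι Φ) (σ : G) : (ι * σ) • Φ = (σ * ι) • Φ := by
  rw [mul_smul, mul_smul, ← h.compl_eq_smul_set, Set.smul_set_compl, (cmType_smul_set h σ).compl_eq_smul_set]

end CMTypes

/-! ### §1. Milne's conditions (a), (b) at `τ = ι`, (c): the predicate `IsCMTypeCocycle`; the Taniyama element satisfies it -/

section Cocycle

variable (K : Type) [Field K] [NumberField K] [IsCMField K]

/-- **Milne's conditions (a), (b) (at `τ = ι`), (c)** of Propositions 4.8 / 4.12 / 4.13 for a family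
`u = (u_Ψ(σ))_{Ψ,σ}`, `u : {CM types on X = Γ_ℚ ⧸ res(Γ_K)} → Γ_ℚ → 𝔸^×_{K,f}/K^×` (w.r.t. the complex conjugation
`c ∈ Γ_ℚ`): (a) `u_Ψ(στ) = u_{τΨ}(σ)·u_Ψ(τ)`; (b) at `τ = ι`: `u_{Ψᶜ}(σ) = ι_K u_Ψ(σ)` — Milne's `u_{Φ(ι⁻¹|E)}(σ) = ι u_Φ(σ)`,
with `Φ(ι⁻¹|E) = Φι_E = ιΦ` the complementary type; (c) `u_Ψ(c) = 1`.  The values of `u` off the CM types are irrelevant.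
[cite: Milne2007FundamentalCM, §4.2 Prop. 4.8, §4.3 Props. 4.12–4.13 (a)(b)(c)] -/
structure IsCMTypeCocycle (c : absoluteGaloisGroup ℚ)
    (u : Set (absoluteGaloisGroup ℚ ⧸ (absGaloisRestrict ℚ K).range) → absoluteGaloisGroup ℚ →
      (FiniteAdeleRing (𝓞 K) K)ˣ ⧸ (FiniteAdeleRing.unitEmbedding (𝓞 K) K).range) : Prop where
  /-- (a) the cocycle identity `u_Ψ(στ) = u_{τΨ}(σ)·u_Ψ(τ)`. -/
  mul : ∀ ⦃Ψ : Set (absoluteGaloisGroup ℚ ⧸ (absGaloisRestrict ℚ K).range)⦄, IsCMTypeWith c Ψ →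
    ∀ σ τ : absoluteGaloisGroup ℚ, u Ψ (σ * τ) = u (τ • Ψ) σ * u Ψ τ
  /-- (b) at `τ = ι`: `u_{Ψᶜ}(σ) = ι_K u_Ψ(σ)`. -/
  compl : ∀ ⦃Ψ : Set (absoluteGaloisGroup ℚ ⧸ (absGaloisRestrict ℚ K).range)⦄, IsCMTypeWith c Ψ →
    ∀ σ : absoluteGaloisGroup ℚ, u Ψᶜ σ = finiteClassConjGal K (u Ψ σ)
  /-- (c) `u_Ψ(ι) = 1`. -/
  self : ∀ ⦃Ψ : Set (absoluteGaloisGroup ℚ ⧸ (absGaloisRestrict ℚ K).range)⦄, IsCMTypeWith c Ψ → u Ψ c = 1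

variable {K} {φ : ℚ →+* ℝ} {c : absoluteGaloisGroup ℚ} (hc : IsComplexConjugation φ c)
  {Ψ : Set (absoluteGaloisGroup ℚ ⧸ (absGaloisRestrict ℚ K).range)} (hΨ : IsCMTypeWith c Ψ)

include hc hΨ in
/-- **PROPOSITION 4.8 (b) at `τ = ι`: `f_{Ψᶜ}(σ) = ι_K f_Ψ(σ)`** («`f_{Φ(ι⁻¹|E)}(σ) = ι f_Φ(σ)`», with `Φ(ι⁻¹|E) = Φι_E = ιΦ` the
complementary CM type).  PROOF by Prop. 4.6's uniqueness, «similarly» to (a): `ι_K f_Ψ(σ)` satisfies (a)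
`art_K(ιf) = θ_c^ab art_K(f) = θ_c^ab F_Ψ(σ) = F_{Ψᶜ}(σ)` (rows A3-G45: `absGaloisConjAb_finiteClassArtinMap`,
`tateHalfTransfer_compl`) and (b) `ιf·ι(ιf) = f·ιf = χ(σ)K^×`. [cite: Milne2007FundamentalCM, §4.2 Prop. 4.8 (b), §4.3 Prop. 4.14 (proof: «ιΦ = Φι_E»)] -/
theorem taniyamaElement_compl (σ : absoluteGaloisGroup ℚ) :
    taniyamaElement K c Ψᶜ σ = finiteClassConjGal K (taniyamaElement K c Ψ σ) := by
  symm
  refine eq_taniyamaElement hc (cmType_compl hΨ) ?_ ?_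
  · rw [← absGaloisConjAb_finiteClassArtinMap hc, finiteClassArtinMap_taniyamaElement hc hΨ, map_inv,
      ← tateHalfTransfer_compl hc hΨ σ]
  · rw [finiteClassConjGal_finiteClassConjGal, ← taniyamaElement_mul_finiteClassConjGal hc hΨ σ]
    exact mul_comm (finiteClassConjGal K (taniyamaElement K c Ψ σ)) (taniyamaElement K c Ψ σ)

include hc in
/-- **The Taniyama element satisfies (a), (b) at `ι`, (c)** (Prop. 4.8 (a), (c) of row A3-G45 and `taniyamaElement_compl`).
[cite: Milne2007FundamentalCM, §4.2 Prop. 4.8] -/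
theorem isCMTypeCocycle_taniyamaElement : IsCMTypeCocycle K c (taniyamaElement K c) where
  mul := fun _ hΨ σ τ => taniyamaElement_mul hc hΨ σ τ
  compl := fun _ hΨ σ => taniyamaElement_compl hc hΨ σ
  self := fun _ hΨ => taniyamaElement_self hc hΨ

/-! #### The dictionary with the printed (b): `Φ(ι⁻¹|E) = Ψι⁻¹ = Ψᶜ` and `ι •` = `ι_K` -/

omit [IsCMField K] in
include hΨ in
/-- **«`ιΦ = Φι_E`»: the right translate `Ψc⁻¹` (row A3-G47's `translateType c Ψ`, Milne's `Φ(ι⁻¹|E)`) of a CM type by the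
conjugation is its complement `Ψᶜ = c • Ψ`** (`c` is central on `X`). [cite: Milne2007FundamentalCM, §4.3 Prop. 4.14 (proof: «using ιΦ = Φι_E»)] -/
theorem translateType_self_eq_compl : translateType c Ψ = Ψᶜ := by
  have key : ∀ g : absoluteGaloisGroup ℚ,
      (((g * c⁻¹ : absoluteGaloisGroup ℚ)) : absoluteGaloisGroup ℚ ⧸ (absGaloisRestrict ℚ K).range) =
        c • ((g : absoluteGaloisGroup ℚ) : absoluteGaloisGroup ℚ ⧸ (absGaloisRestrict ℚ K).range) := by
    intro g
    have h1 : (((g * c⁻¹ : absoluteGaloisGroup ℚ)) : absoluteGaloisGroup ℚ ⧸ (absGaloisRestrict ℚ K).range) =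
        g • c⁻¹ • (((1 : absoluteGaloisGroup ℚ)) : absoluteGaloisGroup ℚ ⧸ (absGaloisRestrict ℚ K).range) := by
      simp only [MulAction.Quotient.smul_coe, smul_eq_mul, mul_one]
    have h2 : c • ((g : absoluteGaloisGroup ℚ) : absoluteGaloisGroup ℚ ⧸ (absGaloisRestrict ℚ K).range) =
        c⁻¹ • g • (((1 : absoluteGaloisGroup ℚ)) : absoluteGaloisGroup ℚ ⧸ (absGaloisRestrict ℚ K).range) := by
      rw [hΨ.inv_smul_eq]
      simp only [MulAction.Quotient.smul_coe, smul_eq_mul, mul_one]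
    rw [h1, h2, hΨ.smul_inv_smul_comm]
  ext q
  rw [mem_translateType, hΨ.compl_eq_smul_set]
  constructor
  · rintro ⟨g, hg, rfl⟩
    rw [key]
    exact Set.smul_mem_smul_set hg
  · intro hq
    obtain ⟨q₀, hq₀, rfl⟩ := Set.mem_smul_set.mp hq
    obtain ⟨g, rfl⟩ := QuotientGroup.mk_surjective q₀
    exact ⟨g, hq₀, key g⟩

/-- **`ι •` on classes is `ι_K`**: row A3-G47's `finiteClassGal K (complexConjRat K)` (the action of `τ|E` for `τ = ι`) is
row A3-G45's `finiteClassConjGal K`. [cite: Milne2007FundamentalCM, §4.2 Prop. 4.8 (b), §4.3 Prop. 4.13 (b)] -/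
theorem finiteClassGal_complexConjRat_eq (f : (FiniteAdeleRing (𝓞 K) K)ˣ ⧸ (FiniteAdeleRing.unitEmbedding (𝓞 K) K).range) :
    finiteClassGal K (complexConjRat K) f = finiteClassConjGal K f := by
  induction f using QuotientGroup.induction_on with
  | H y => rw [finiteClassGal_mk, finiteClassConjGal_mk, finiteIdeleConjGal_eq_finiteIdeleGal]

/-- **From the printed (b) to clause `compl`**: if a family satisfies (a), (c) and Milne's (b)
«`u_{Φ(τ⁻¹|E)}(σ) = τ u_Φ(σ)` if `τE = E`» at least for `τ = ι` (which maps `e(K)` onto itself acting as `ι_K`,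
`smul_absEmbedding_eq_complexConjRat`), then it is an `IsCMTypeCocycle`. [cite: Milne2007FundamentalCM, §4.3 Props. 4.12–4.13 (b)] -/
theorem IsCMTypeCocycle.of_translateType
    {u : Set (absoluteGaloisGroup ℚ ⧸ (absGaloisRestrict ℚ K).range) → absoluteGaloisGroup ℚ →
      (FiniteAdeleRing (𝓞 K) K)ˣ ⧸ (FiniteAdeleRing.unitEmbedding (𝓞 K) K).range}
    (ha : ∀ ⦃Ψ : Set (absoluteGaloisGroup ℚ ⧸ (absGaloisRestrict ℚ K).range)⦄, IsCMTypeWith c Ψ →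
      ∀ σ τ : absoluteGaloisGroup ℚ, u Ψ (σ * τ) = u (τ • Ψ) σ * u Ψ τ)
    (hb : ∀ ⦃Ψ : Set (absoluteGaloisGroup ℚ ⧸ (absGaloisRestrict ℚ K).range)⦄, IsCMTypeWith c Ψ →
      ∀ σ : absoluteGaloisGroup ℚ, u (translateType c Ψ) σ = finiteClassGal K (complexConjRat K) (u Ψ σ))
    (hself : ∀ ⦃Ψ : Set (absoluteGaloisGroup ℚ ⧸ (absGaloisRestrict ℚ K).range)⦄, IsCMTypeWith c Ψ → u Ψ c = 1) :
    IsCMTypeCocycle K c u where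
  mul := ha
  compl := fun _ hΨ σ => by rw [← translateType_self_eq_compl hΨ, hb hΨ σ, finiteClassGal_complexConjRat_eq]
  self := hself

end Cocycle

/-! ### §2. Proposition 4.13: the predicate `IsTaniyamaDefect` and its proof for `e = g/f` -/

section Defect

variable (K : Type) [Field K] [NumberField K] [IsCMField K]

/-- **PROPOSITION 4.13 AS A PREDICATE**: a family `e = (e_Ψ(σ))` with (a) `e_Ψ(στ) = e_{τΨ}(σ)·e_Ψ(τ)`, (b) at `τ = ι`
`e_{Ψᶜ}(σ) = ι_K e_Ψ(σ)`, (c) `e_Ψ(ι) = 1` (these three = `IsCMTypeCocycle`), **(d) `e_Ψ(σ)·ι_K e_Ψ(σ) = 1`** and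
**(e) `e_Ψ(σ) = 1` if `σΨ = Ψ`** («the condition `σΦ = Φ` in (e) means that `σ` fixes the reflex field of `(E, Φ)`»).
Milne's `e_Φ = g_Φ/f_Φ` satisfies it (`isTaniyamaDefect_div_taniyamaElement`). [cite: Milne2007FundamentalCM, §4.3 Prop. 4.13] -/
structure IsTaniyamaDefect (c : absoluteGaloisGroup ℚ)
    (e : Set (absoluteGaloisGroup ℚ ⧸ (absGaloisRestrict ℚ K).range) → absoluteGaloisGroup ℚ →
      (FiniteAdeleRing (𝓞 K) K)ˣ ⧸ (FiniteAdeleRing.unitEmbedding (𝓞 K) K).range) : Prop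
    extends IsCMTypeCocycle K c e where
  /-- (d) `e_Ψ(σ)·ι_K e_Ψ(σ) = 1`. -/
  mul_conj : ∀ ⦃Ψ : Set (absoluteGaloisGroup ℚ ⧸ (absGaloisRestrict ℚ K).range)⦄, IsCMTypeWith c Ψ →
    ∀ σ : absoluteGaloisGroup ℚ, e Ψ σ * finiteClassConjGal K (e Ψ σ) = 1
  /-- (e) `e_Ψ(σ) = 1` if `σΨ = Ψ`. -/
  eq_one_of_smul_set_eq : ∀ ⦃Ψ : Set (absoluteGaloisGroup ℚ ⧸ (absGaloisRestrict ℚ K).range)⦄, IsCMTypeWith c Ψ →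
    ∀ ⦃σ : absoluteGaloisGroup ℚ⦄, σ • Ψ = Ψ → e Ψ σ = 1

variable {K} {φ : ℚ →+* ℝ} {c : absoluteGaloisGroup ℚ} (hc : IsComplexConjugation φ c)

include hc in
/-- **PROOF OF PROPOSITION 4.13.**  Let `g = (g_Ψ(σ))` satisfy Prop. 4.12 (a), (b) at `τ = ι`, (c) (`IsCMTypeCocycle K c g`)
and (d) `g_Ψ(σ)·ι_K g_Ψ(σ) = χ(σ)K^×`, and agree with the Taniyama element on the stabilisers — `g_Ψ(σ) = f_Ψ(σ)` whenever
`σΨ = Ψ` («as we observed in the preceding subsection, the fundamental theorem is known to hold in that case»: Thm. 3.10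
with Prop. 4.9, row A3-G46).  Then `e_Ψ(σ) = g_Ψ(σ)/f_Ψ(σ)` satisfies Prop. 4.13 (a)–(e): «(a), (b), and (c) follow from
(a), (b), and (c) of 4.8 and 4.12, and (d) follows from 4.6 (b) and 4.12 (d)» (in the commutative group `Q`), (e) is
`g = f` there. [cite: Milne2007FundamentalCM, §4.3 Prop. 4.13 (proof)] -/
theorem isTaniyamaDefect_div_taniyamaElement
    {g : Set (absoluteGaloisGroup ℚ ⧸ (absGaloisRestrict ℚ K).range) → absoluteGaloisGroup ℚ →
      (FiniteAdeleRing (𝓞 K) K)ˣ ⧸ (FiniteAdeleRing.unitEmbedding (𝓞 K) K).range}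
    (hg : IsCMTypeCocycle K c g)
    (hd : ∀ ⦃Ψ : Set (absoluteGaloisGroup ℚ ⧸ (absGaloisRestrict ℚ K).range)⦄, IsCMTypeWith c Ψ →
      ∀ σ : absoluteGaloisGroup ℚ, g Ψ σ * finiteClassConjGal K (g Ψ σ) = QuotientGroup.mk (cyclotomicFiniteIdeleIn K σ))
    (he : ∀ ⦃Ψ : Set (absoluteGaloisGroup ℚ ⧸ (absGaloisRestrict ℚ K).range)⦄, IsCMTypeWith c Ψ →
      ∀ ⦃σ : absoluteGaloisGroup ℚ⦄, σ • Ψ = Ψ → g Ψ σ = taniyamaElement K c Ψ σ) :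
    IsTaniyamaDefect K c (fun Ψ σ => g Ψ σ / taniyamaElement K c Ψ σ) where
  mul := by
    intro Ψ hΨ σ τ
    rw [hg.mul hΨ σ τ, taniyamaElement_mul hc hΨ σ τ]
    exact (div_mul_div_comm (g (τ • Ψ) σ) (taniyamaElement K c (τ • Ψ) σ) (g Ψ τ) (taniyamaElement K c Ψ τ)).symm
  compl := by
    intro Ψ hΨ σ
    rw [hg.compl hΨ σ, taniyamaElement_compl hc hΨ σ]
    exact (map_div (finiteClassConjGal K) (g Ψ σ) (taniyamaElement K c Ψ σ)).symm
  self := by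
    intro Ψ hΨ
    rw [hg.self hΨ, taniyamaElement_self hc hΨ]
    exact div_one (1 : (FiniteAdeleRing (𝓞 K) K)ˣ ⧸ (FiniteAdeleRing.unitEmbedding (𝓞 K) K).range)
  mul_conj := by
    intro Ψ hΨ σ
    calc g Ψ σ / taniyamaElement K c Ψ σ * finiteClassConjGal K (g Ψ σ / taniyamaElement K c Ψ σ)
        = g Ψ σ / taniyamaElement K c Ψ σ *
            (finiteClassConjGal K (g Ψ σ) / finiteClassConjGal K (taniyamaElement K c Ψ σ)) :=
          congrArg (g Ψ σ / taniyamaElement K c Ψ σ * ·)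
            (map_div (finiteClassConjGal K) (g Ψ σ) (taniyamaElement K c Ψ σ))
      _ = g Ψ σ * finiteClassConjGal K (g Ψ σ) /
            (taniyamaElement K c Ψ σ * finiteClassConjGal K (taniyamaElement K c Ψ σ)) :=
          div_mul_div_comm (g Ψ σ) (taniyamaElement K c Ψ σ) (finiteClassConjGal K (g Ψ σ))
            (finiteClassConjGal K (taniyamaElement K c Ψ σ))
      _ = (QuotientGroup.mk (cyclotomicFiniteIdeleIn K σ) :
              (FiniteAdeleRing (𝓞 K) K)ˣ ⧸ (FiniteAdeleRing.unitEmbedding (𝓞 K) K).range) /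
            QuotientGroup.mk (cyclotomicFiniteIdeleIn K σ) := by
          rw [hd hΨ σ, taniyamaElement_mul_finiteClassConjGal hc hΨ σ]
      _ = 1 := div_self' (QuotientGroup.mk (cyclotomicFiniteIdeleIn K σ))
  eq_one_of_smul_set_eq := by
    intro Ψ hΨ σ hσ
    rw [he hΨ hσ]
    exact div_self' (taniyamaElement K c Ψ σ)

include hc in
/-- **The printed (b) for every `τ` with `τE = E` passes from `g` to `e = g/f`**: if `τ ∈ Γ_ℚ` maps `e(K)` onto itself acting
as `α ∈ Aut(K)` and `g_{Ψτ⁻¹}(σ) = α • g_Ψ(σ)`, then `e_{Ψτ⁻¹}(σ) = α • e_Ψ(σ)` — by row A3-G47's Prop. 4.8 (b)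
`f_{Ψτ⁻¹}(σ) = α • f_Ψ(σ)`. [cite: Milne2007FundamentalCM, §4.3 Prop. 4.13 (b) («follow from (b) of 4.8 and 4.12»)] -/
theorem div_taniyamaElement_translateType {Ψ : Set (absoluteGaloisGroup ℚ ⧸ (absGaloisRestrict ℚ K).range)}
    (hΨ : IsCMTypeWith c Ψ) {τ : absoluteGaloisGroup ℚ} {α : K ≃ₐ[ℚ] K}
    (hτ : ∀ x : K, τ • (absEmbedding ℚ K x : AlgebraicClosure ℚ) = absEmbedding ℚ K (α x))
    {g : Set (absoluteGaloisGroup ℚ ⧸ (absGaloisRestrict ℚ K).range) → absoluteGaloisGroup ℚ →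
      (FiniteAdeleRing (𝓞 K) K)ˣ ⧸ (FiniteAdeleRing.unitEmbedding (𝓞 K) K).range}
    (σ : absoluteGaloisGroup ℚ) (hg : g (translateType τ Ψ) σ = finiteClassGal K α (g Ψ σ)) :
    g (translateType τ Ψ) σ / taniyamaElement K c (translateType τ Ψ) σ =
      finiteClassGal K α (g Ψ σ / taniyamaElement K c Ψ σ) := by
  rw [hg, taniyamaElement_translateType hc hΨ hτ σ]
  exact (map_div (finiteClassGal K α) (g Ψ σ) (taniyamaElement K c Ψ σ)).symm

end Defect

/-! ### §3. Proposition 4.14 from the predicate -/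

namespace IsTaniyamaDefect

variable {K : Type} [Field K] [NumberField K] [IsCMField K] {c : absoluteGaloisGroup ℚ}
  {e : Set (absoluteGaloisGroup ℚ ⧸ (absGaloisRestrict ℚ K).range) → absoluteGaloisGroup ℚ →
    (FiniteAdeleRing (𝓞 K) K)ˣ ⧸ (FiniteAdeleRing.unitEmbedding (𝓞 K) K).range}
  (he : IsTaniyamaDefect K c e) {Ψ : Set (absoluteGaloisGroup ℚ ⧸ (absGaloisRestrict ℚ K).range)} (hΨ : IsCMTypeWith c Ψ)
include he hΨ

/-- **«Replacing `τ` by `σ⁻¹τ` in (a), we find that `e_Φ(τ) = e_Φ(σ)` if `τΦ = σΦ`»** — `e_Ψ(σ)` depends only on `σΨ`, i.e.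
only on the class of `σ` modulo the stabiliser of `Ψ` («the restriction of `σ` to the reflex field»).
[cite: Milne2007FundamentalCM, §4.3 Prop. 4.14 (proof)] -/
theorem eq_of_smul_set_eq {σ τ : absoluteGaloisGroup ℚ} (h : τ • Ψ = σ • Ψ) : e Ψ τ = e Ψ σ := by
  have hfix : (σ⁻¹ * τ) • Ψ = Ψ := by rw [mul_smul, h, inv_smul_smul]
  rw [← mul_inv_cancel_left σ τ, he.mul hΨ σ (σ⁻¹ * τ), hfix, he.eq_one_of_smul_set_eq hΨ hfix]
  exact mul_one (e Ψ σ)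

/-- **(e) restated: `e_Ψ(σ) = 1` if `σΨ = Ψ`** («is `1` if `σ|E* = id`»). [cite: Milne2007FundamentalCM, §4.3 Prop. 4.14] -/
theorem apply_eq_one {σ : absoluteGaloisGroup ℚ} (h : σ • Ψ = Ψ) : e Ψ σ = 1 :=
  he.eq_one_of_smul_set_eq hΨ h

/-- **«Putting `τ = ι` in (a) and using (c) we find that `e_Φ(σι) = ι e_Φ(σ)`»** (with (b) at `ι`: `e_{ιΦ}(σ) = ι e_Φ(σ)`).
[cite: Milne2007FundamentalCM, §4.3 Prop. 4.14 (proof)] -/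
theorem apply_mul_self (σ : absoluteGaloisGroup ℚ) : e Ψ (σ * c) = finiteClassConjGal K (e Ψ σ) := by
  rw [he.mul hΨ σ c, he.self hΨ, ← hΨ.compl_eq_smul_set, he.compl hΨ σ]
  exact mul_one (finiteClassConjGal K (e Ψ σ))

/-- **«Putting `σ = ι` in (a) and using (c) we find that `e_Φ(ισ) = e_Φ(σ)`»**. [cite: Milne2007FundamentalCM, §4.3 Prop. 4.14 (proof)] -/
theorem apply_self_mul (σ : absoluteGaloisGroup ℚ) : e Ψ (c * σ) = e Ψ σ := by
  rw [he.mul hΨ c σ, he.self (cmType_smul_set hΨ σ)]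
  exact one_mul (e Ψ σ)

/-- **«Since `ισ` and `σι` have the same effect on `E*`, we conclude `e_Φ(σ) = ι e_Φ(σ)`»**: every value of `e` is fixed by
`ι_K`. [cite: Milne2007FundamentalCM, §4.3 Prop. 4.14 (proof)] -/
theorem finiteClassConjGal_apply (σ : absoluteGaloisGroup ℚ) : finiteClassConjGal K (e Ψ σ) = e Ψ σ := by
  rw [← he.apply_mul_self hΨ σ, he.eq_of_smul_set_eq hΨ (smul_set_comm_of_isCMTypeWith hΨ σ).symm,
    he.apply_self_mul hΨ σ]

/-- **«Finally, (d) shows that `e_Φ(σ)² = 1`»** (`e·ιe = 1` and `ιe = e`). [cite: Milne2007FundamentalCM, §4.3 Prop. 4.14] -/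
theorem sq_eq_one (σ : absoluteGaloisGroup ℚ) : e Ψ σ ^ 2 = 1 := by
  have h := he.mul_conj hΨ σ
  rw [he.finiteClassConjGal_apply hΨ σ] at h
  exact (sq (e Ψ σ)).trans h

/-- `e_Ψ(σ)⁻¹ = e_Ψ(σ)`. [cite: Milne2007FundamentalCM, §4.3 Prop. 4.14] -/
theorem inv_apply (σ : absoluteGaloisGroup ℚ) : (e Ψ σ)⁻¹ = e Ψ σ := by
  exact inv_eq_of_mul_eq_one_right (((sq (e Ψ σ)).symm.trans (he.sq_eq_one hΨ σ)))

/-- `e_{Ψᶜ}(σ) = e_Ψ(σ)` — with (b) at `ι`: the value does not change under `Φ ↦ ιΦ`. [cite: Milne2007FundamentalCM, §4.3 Prop. 4.14 (proof)] -/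
theorem apply_compl (σ : absoluteGaloisGroup ℚ) : e Ψᶜ σ = e Ψ σ := by
  rw [he.compl hΨ σ, he.finiteClassConjGal_apply hΨ σ]

/-- `e` is multiplicative on the stabiliser of `Ψ`: `e_Ψ(στ) = e_Ψ(σ)·e_Ψ(τ)` for `τΨ = Ψ` (so `e_Ψ(στ) = e_Ψ(σ)`).
[cite: Milne2007FundamentalCM, §4.3 Prop. 4.14 (proof)] -/
theorem apply_mul_of_smul_set_eq (σ : absoluteGaloisGroup ℚ) {τ : absoluteGaloisGroup ℚ} (hτ : τ • Ψ = Ψ) :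
    e Ψ (σ * τ) = e Ψ σ := by
  rw [he.mul hΨ σ τ, hτ, he.eq_one_of_smul_set_eq hΨ hτ]
  exact mul_one (e Ψ σ)

end IsTaniyamaDefect

/-! ### §4. «which equals `𝔸^×_{f,F}/F^×` by Hilbert's Theorem 90»: `ι_K`-fixed classes come from `K⁺` -/

section Hilbert90

variable (K : Type) [Field K] [NumberField K] [IsCMField K]

/-- **Hilbert's Theorem 90 for `K/K⁺`, written out**: if `b·b̄ = 1` then `t̄ = b·t` for some `t ≠ 0` — take `t = 1 + b̄`
(`b(1 + b̄) = b + 1`), or, when `b̄ = -1` (i.e. `b = -1`), a non-zero `t` with `t̄ = -t`.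
[cite: Milne2007FundamentalCM, §4.3 Prop. 4.14 (proof, footnote: «H¹(Gal(E/F), E^×) = 0»)] -/
theorem exists_complexConj_eq_mul_of_mul_complexConj_eq_one {b : K} (hb : b * IsCMField.complexConj K b = 1) :
    ∃ t : K, t ≠ 0 ∧ IsCMField.complexConj K t = b * t := by
  by_cases h : IsCMField.complexConj K b = -1
  · have hb1 : b = -1 := by
      have h' := congrArg (IsCMField.complexConj K) h
      rwa [IsCMField.complexConj_apply_apply, map_neg, map_one] at h'
    obtain ⟨x, hx⟩ := IsCMField.exists_complexConj_ne K
    refine ⟨x - IsCMField.complexConj K x, sub_ne_zero.mpr hx.symm, ?_⟩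
    rw [map_sub, IsCMField.complexConj_apply_apply, hb1, neg_one_mul, neg_sub]
  · refine ⟨1 + IsCMField.complexConj K b, fun h0 => h (eq_neg_of_add_eq_zero_right h0), ?_⟩
    rw [map_add, map_one, IsCMField.complexConj_apply_apply, mul_add, mul_one, hb, add_comm]

/-- **The `ι`-fixed part of `𝔸_{K,f}` is `con(𝔸_{K⁺,f})`**: write `z = con X + α·con Y` with `ᾱ = -α` (row A3-G43 FILE 2
`exists_eq_mapSemialgHom_add_mul`); `ιz = con X - α·con Y`, so `ιz = z` forces `2α·con Y = 0`, `con Y = 0`.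
[cite: CasselsFrohlichANT1967, Ch. II §14 Lemma (14.2) («V_k ⊗_k K = V_K»)] [cite: Milne2007FundamentalCM, §4.3 Prop. 4.14 (proof)] -/
theorem exists_eq_mapSemialgHom_of_finiteAdeleComplexConj_eq {z : FiniteAdeleRing (𝓞 K) K}
    (hz : finiteAdeleComplexConj K z = z) :
    ∃ X : FiniteAdeleRing (𝓞 (maximalRealSubfield K)) (maximalRealSubfield K),
      z = FiniteAdeleRing.mapSemialgHom (𝓞 (maximalRealSubfield K)) (maximalRealSubfield K) K (𝓞 K) X := by
  obtain ⟨x, hx⟩ := IsCMField.exists_complexConj_ne K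
  set α : K := x - IsCMField.complexConj K x with hαdef
  have hα : IsCMField.complexConj K α = -α := by
    rw [hαdef, map_sub, IsCMField.complexConj_apply_apply, neg_sub]
  have hα0 : α ≠ 0 := sub_ne_zero.mpr hx.symm
  obtain ⟨X, Y, hXY⟩ := exists_eq_mapSemialgHom_add_mul hα hα0 z
  refine ⟨X, ?_⟩
  have hι : finiteAdeleComplexConj K z =
      FiniteAdeleRing.mapSemialgHom (𝓞 (maximalRealSubfield K)) (maximalRealSubfield K) K (𝓞 K) X -
        algebraMap K (FiniteAdeleRing (𝓞 K) K) α *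
          FiniteAdeleRing.mapSemialgHom (𝓞 (maximalRealSubfield K)) (maximalRealSubfield K) K (𝓞 K) Y := by
    rw [hXY, map_add, map_mul, finiteAdeleComplexConj_mapSemialgHom, finiteAdeleComplexConj_mapSemialgHom,
      finiteAdeleComplexConj_algebraMap, hα, map_neg, neg_mul, sub_eq_add_neg]
  have hu : IsUnit (algebraMap K (FiniteAdeleRing (𝓞 K) K) (2 * α)) :=
    (IsUnit.mk0 (2 * α) (mul_ne_zero two_ne_zero hα0)).map (algebraMap K (FiniteAdeleRing (𝓞 K) K))
  have h2 := hz
  rw [hι, hXY] at h2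
  have hY : FiniteAdeleRing.mapSemialgHom (𝓞 (maximalRealSubfield K)) (maximalRealSubfield K) K (𝓞 K) Y = 0 := by
    rw [← hu.mul_right_eq_zero, map_mul, map_ofNat]
    linear_combination (-1 : FiniteAdeleRing (𝓞 K) K) * h2
  rw [hXY, hY, mul_zero, add_zero]

omit [IsCMField K] in
/-- **`con : 𝔸_{K⁺,f} → 𝔸_{K,f}` is injective** (place by place: `K⁺_v → K_w` is a field embedding and every `v` has a `w`
above it; the tree's `Automorphic.FiniteAdeleRing.baseChange_injective`). [cite: CasselsFrohlichANT1967, Ch. II §19 («a homeomorphism of J_k with a closed subset of J_K»)] -/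
theorem mapSemialgHom_maximalRealSubfield_injective :
    Function.Injective (FiniteAdeleRing.mapSemialgHom (𝓞 (maximalRealSubfield K)) (maximalRealSubfield K) K (𝓞 K)) := by
  intro x y h
  rw [finiteAdeleRing_mapSemialgHom_apply_eq_baseChange, finiteAdeleRing_mapSemialgHom_apply_eq_baseChange] at h
  haveI : FaithfulSMul (𝓞 (maximalRealSubfield K)) (𝓞 K) :=
    FaithfulSMul.of_field_isFractionRing (𝓞 (maximalRealSubfield K)) (𝓞 K) (maximalRealSubfield K) K
  exact Literature.NumberTheory.Automorphic.FiniteAdeleRing.baseChange_injective (𝓞 (maximalRealSubfield K))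
    (maximalRealSubfield K) K (𝓞 K) h

omit [IsCMField K] in
/-- `con` on finite idèles (flt-inv's `finiteIdeleConorm K⁺ K`) is injective. [cite: CasselsFrohlichANT1967, Ch. II §19 (19.2)] -/
theorem finiteIdeleConorm_maximalRealSubfield_injective :
    Function.Injective (finiteIdeleConorm (maximalRealSubfield K) K) :=
  Units.map_injective (mapSemialgHom_maximalRealSubfield_injective K)

/-- **`ι_K` fixes `con(y)`** for every finite idèle `y` of `K⁺`. [cite: CasselsFrohlichANT1967, Ch. II §19 (19.3)] [cite: Milne2007FundamentalCM, §4.3 Prop. 4.14] -/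
theorem finiteIdeleConjGal_finiteIdeleConorm (y : (FiniteAdeleRing (𝓞 (maximalRealSubfield K)) (maximalRealSubfield K))ˣ) :
    finiteIdeleConjGal K (finiteIdeleConorm (maximalRealSubfield K) K y) = finiteIdeleConorm (maximalRealSubfield K) K y := by
  rw [finiteIdeleConjGal_eq_finiteIdeleComplexConj]
  exact Units.ext (by
    rw [coe_finiteIdeleComplexConj, coe_finiteIdeleConorm, finiteAdeleComplexConj_mapSemialgHom])

/-- On classes: `ι_K (con(y)·K^×) = con(y)·K^×`. [cite: Milne2007FundamentalCM, §4.3 Prop. 4.14] -/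
theorem finiteClassConjGal_mk_finiteIdeleConorm (y : (FiniteAdeleRing (𝓞 (maximalRealSubfield K)) (maximalRealSubfield K))ˣ) :
    finiteClassConjGal K (QuotientGroup.mk (finiteIdeleConorm (maximalRealSubfield K) K y)) =
      QuotientGroup.mk (finiteIdeleConorm (maximalRealSubfield K) K y) := by
  rw [finiteClassConjGal_mk, finiteIdeleConjGal_finiteIdeleConorm]

/-- **An `ι_K`-fixed finite IDÈLE of `K` is `con(y)` for a finite idèle `y` of `K⁺`** (apply the previous lemma to `z` and to
`z⁻¹`; `con` injective). [cite: CasselsFrohlichANT1967, Ch. II §19 (19.2)–(19.3)] [cite: Milne2007FundamentalCM, §4.3 Prop. 4.14 (proof)] -/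
theorem exists_finiteIdeleConorm_eq_of_finiteIdeleConjGal_eq {z : (FiniteAdeleRing (𝓞 K) K)ˣ}
    (hz : finiteIdeleConjGal K z = z) :
    ∃ y : (FiniteAdeleRing (𝓞 (maximalRealSubfield K)) (maximalRealSubfield K))ˣ,
      finiteIdeleConorm (maximalRealSubfield K) K y = z := by
  have hz1 : finiteAdeleComplexConj K ((z : (FiniteAdeleRing (𝓞 K) K)ˣ) : FiniteAdeleRing (𝓞 K) K) = z := by
    rw [← coe_finiteIdeleComplexConj, ← finiteIdeleConjGal_eq_finiteIdeleComplexConj, hz]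
  have hz2 : finiteAdeleComplexConj K ((z⁻¹ : (FiniteAdeleRing (𝓞 K) K)ˣ) : FiniteAdeleRing (𝓞 K) K) =
      ((z⁻¹ : (FiniteAdeleRing (𝓞 K) K)ˣ) : FiniteAdeleRing (𝓞 K) K) := by
    rw [← coe_finiteIdeleComplexConj, ← finiteIdeleConjGal_eq_finiteIdeleComplexConj, map_inv, hz]
  obtain ⟨X, hX⟩ := exists_eq_mapSemialgHom_of_finiteAdeleComplexConj_eq K hz1
  obtain ⟨X', hX'⟩ := exists_eq_mapSemialgHom_of_finiteAdeleComplexConj_eq K hz2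
  have h1 : X * X' = 1 := mapSemialgHom_maximalRealSubfield_injective K (by
    rw [map_mul, map_one, ← hX, ← hX', Units.mul_inv])
  have h2 : X' * X = 1 := by rw [mul_comm]; exact h1
  exact ⟨⟨X, X', h1, h2⟩, Units.ext (by rw [coe_finiteIdeleConorm]; exact hX.symm)⟩

omit [IsCMField K] in
/-- There is a finite prime (`𝓞 K` is not a field). [folklore] -/
private theorem nonempty_heightOneSpectrum : Nonempty (HeightOneSpectrum (𝓞 K)) := by
  obtain ⟨M, hM⟩ := Ideal.exists_maximal (𝓞 K)
  exact ⟨⟨M, hM.isPrime, Ring.ne_bot_of_isMaximal_of_not_isField hM (RingOfIntegers.not_isField K)⟩⟩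

omit [IsCMField K] in
/-- `K → 𝔸_{K,f}` is injective. [folklore] -/
private theorem algebraMap_finiteAdeleRing_injective :
    Function.Injective (algebraMap K (FiniteAdeleRing (𝓞 K) K)) := by
  obtain ⟨v⟩ := nonempty_heightOneSpectrum K
  intro a b h
  have h' := congrArg (fun z : FiniteAdeleRing (𝓞 K) K => z v) h
  simp only [FiniteAdeleRing.algebraMap_apply] at h'
  exact (algebraMap K (v.adicCompletion K)).injective h'

omit [IsCMField K] in
/-- `K^× → (𝔸_{K,f})ˣ` is injective. [folklore] -/
private theorem unitEmbedding_injective : Function.Injective (FiniteAdeleRing.unitEmbedding (𝓞 K) K) :=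
  Units.map_injective (algebraMap_finiteAdeleRing_injective K)

/-- **HILBERT 90 ON CLASSES — «`(𝔸^×_{f,E}/E^×)^{⟨ι_E⟩} = 𝔸^×_{f,F}/F^×`»**: a class `φ ∈ 𝔸^×_{K,f}/K^×` fixed by `ι_K` is
`con(y)·K^×` for a finite idèle `y` of `K⁺`.  PROOF (the footnote's cohomology sequence, by hand): `φ = x·K^×` with
`ιx = x·(b)⁻¹`, `b ∈ K^×`; applying `ι`, `b·b̄ = 1`; Hilbert 90 gives `t ∈ K^×` with `t̄ = bt`, and then `z = x·(t)` is
`ι`-fixed, hence `z = con(y)`. [cite: Milne2007FundamentalCM, §4.3 Prop. 4.14 (proof, with footnote)] -/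
theorem exists_eq_mk_finiteIdeleConorm_of_finiteClassConjGal_eq
    {φ : (FiniteAdeleRing (𝓞 K) K)ˣ ⧸ (FiniteAdeleRing.unitEmbedding (𝓞 K) K).range} (hφ : finiteClassConjGal K φ = φ) :
    ∃ y : (FiniteAdeleRing (𝓞 (maximalRealSubfield K)) (maximalRealSubfield K))ˣ,
      φ = QuotientGroup.mk (finiteIdeleConorm (maximalRealSubfield K) K y) := by
  induction φ using QuotientGroup.induction_on with
  | H x =>
    rw [finiteClassConjGal_mk, QuotientGroup.eq] at hφ
    obtain ⟨b, hb⟩ := hφ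
    -- `hb : (b) = (ιx)⁻¹·x`; applying `ι`: `(b̄) = (b)⁻¹`, so `b·b̄ = 1`
    have h1 : finiteIdeleConjGal K (FiniteAdeleRing.unitEmbedding (𝓞 K) K b) =
        (FiniteAdeleRing.unitEmbedding (𝓞 K) K b)⁻¹ := by
      rw [hb, map_mul, map_inv, finiteIdeleConjGal_finiteIdeleConjGal, mul_inv_rev, inv_inv]
    have h2 : Units.map (IsCMField.complexConj K : K →* K) b = b⁻¹ :=
      unitEmbedding_injective K (by rw [← finiteIdeleConjGal_unitEmbedding, map_inv, h1])
    have hbb : (b : K) * IsCMField.complexConj K b = 1 := by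
      have h3 := congrArg (fun u : Kˣ => (u : K)) h2
      simp only [Units.coe_map, MonoidHom.coe_coe, Units.val_inv_eq_inv_val] at h3
      rw [h3, mul_inv_cancel₀ b.ne_zero]
    obtain ⟨t, ht0, ht⟩ := exists_complexConj_eq_mul_of_mul_complexConj_eq_one K hbb
    -- `z = x·(t)` is `ι`-fixed
    have hx : finiteIdeleConjGal K x * FiniteAdeleRing.unitEmbedding (𝓞 K) K b = x := by
      rw [hb, mul_inv_cancel_left]
    have hct : Units.map (IsCMField.complexConj K : K →* K) (Units.mk0 t ht0) = b * Units.mk0 t ht0 :=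
      Units.ext (by simp only [Units.coe_map, MonoidHom.coe_coe, Units.val_mk0, Units.val_mul]; exact ht)
    have hz : finiteIdeleConjGal K (x * FiniteAdeleRing.unitEmbedding (𝓞 K) K (Units.mk0 t ht0)) =
        x * FiniteAdeleRing.unitEmbedding (𝓞 K) K (Units.mk0 t ht0) := by
      rw [map_mul, finiteIdeleConjGal_unitEmbedding, hct, map_mul, ← mul_assoc, hx]
    obtain ⟨y, hy⟩ := exists_finiteIdeleConorm_eq_of_finiteIdeleConjGal_eq K hz
    refine ⟨y, ?_⟩
    rw [hy, QuotientGroup.eq, inv_mul_cancel_left]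
    exact ⟨_, rfl⟩

end Hilbert90

/-! ### §5. Corollary 4.15: classes of order `≤ 2` from `K⁺` are represented by sign idèles `ε`, `ε² = 1` -/

section Signs

/-- **«an element of `F^×` that is a square locally at all finite primes is a square, so we can correct `e` to achieve
`e² = 1`»**: if `y² = (k)` for a finite idèle `y` of a number field `F` and `k ∈ F^×`, then `k` is a square in every `F_v`,
hence `k = b²` in `F` (Global Square Theorem, the tree's `QuadraticForms.globalSquareTheorem_holds`), and `ε = y/(b)` has
`ε² = 1`. [cite: Milne2007FundamentalCM, §4.3 Cor. 4.15 (proof)] [cite: Omeara1963, §65C Thm. 65:15] -/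
theorem exists_div_unitEmbedding_sq_eq_one (F : Type) [Field F] [NumberField F]
    {y : (FiniteAdeleRing (𝓞 F) F)ˣ} {k : Fˣ} (h : y ^ 2 = FiniteAdeleRing.unitEmbedding (𝓞 F) F k) :
    ∃ b : Fˣ, (y / FiniteAdeleRing.unitEmbedding (𝓞 F) F b) ^ 2 = 1 := by
  have hsq : ∀ v : HeightOneSpectrum (𝓞 F), IsSquare (algebraMap F (v.adicCompletion F) (k : F)) := by
    intro v
    refine ⟨((y : (FiniteAdeleRing (𝓞 F) F)ˣ) : FiniteAdeleRing (𝓞 F) F) v, ?_⟩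
    have h' := congrArg (fun u : (FiniteAdeleRing (𝓞 F) F)ˣ => ((u : FiniteAdeleRing (𝓞 F) F) v)) h
    simp only [Units.val_pow_eq_pow_val, FiniteAdeleRing.unitEmbedding_apply] at h'
    rw [sq, Literature.NumberTheory.Automorphic.FiniteAdeleRing.mul_apply', FiniteAdeleRing.algebraMap_apply] at h'
    exact h'.symm
  obtain ⟨b, hb⟩ : IsSquare (k : F) :=
    Literature.NumberTheory.QuadraticForms.globalSquareTheorem_holds F (k : F) (Filter.Eventually.of_forall hsq)
  have hb0 : b ≠ 0 := fun h0 => k.ne_zero (by rw [hb, h0, mul_zero])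
  refine ⟨Units.mk0 b hb0, ?_⟩
  have hk : k = Units.mk0 b hb0 ^ 2 := Units.ext (by rw [Units.val_pow_eq_pow_val, Units.val_mk0, sq]; exact hb)
  rw [div_pow, h, hk, map_pow, div_self']

variable (K : Type) [Field K] [NumberField K] [IsCMField K]

/-- The `v`-components of a finite idèle `ε` with `ε² = 1` are `±1`: «`e = (e_v)_v`, `e_v = ±1`».
[cite: Milne2007FundamentalCM, §4.4 (first display: «e_Φ(σ) ∈ μ₂(𝔸_{f,F})/μ₂(F)»)] -/
theorem apply_eq_one_or_eq_neg_one_of_sq_eq_one (F : Type) [Field F] [NumberField F]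
    {ε : (FiniteAdeleRing (𝓞 F) F)ˣ} (h : ε ^ 2 = 1) (v : HeightOneSpectrum (𝓞 F)) :
    ((ε : (FiniteAdeleRing (𝓞 F) F)ˣ) : FiniteAdeleRing (𝓞 F) F) v = 1 ∨
      ((ε : (FiniteAdeleRing (𝓞 F) F)ˣ) : FiniteAdeleRing (𝓞 F) F) v = -1 := by
  have h' := congrArg (fun u : (FiniteAdeleRing (𝓞 F) F)ˣ => ((u : FiniteAdeleRing (𝓞 F) F) v)) h
  have h1 : (1 : FiniteAdeleRing (𝓞 F) F) v = 1 := rfl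
  simp only [Units.val_pow_eq_pow_val, Units.val_one] at h'
  rw [sq, Literature.NumberTheory.Automorphic.FiniteAdeleRing.mul_apply', h1] at h'
  exact mul_self_eq_one_iff.mp h'

/-- **COROLLARY 4.15's number theory for the CM field `K`**: a class `con(y)·K^×` (`y` a finite idèle of `K⁺`) whose square is
trivial is `con(ε)·K^×` for some `ε ∈ (𝔸_{K⁺,f})ˣ` with `ε² = 1` — `con(y²) = (k)` with `k̄ = k` (both sides `ι`-fixed), so
`k ∈ K⁺`, `y² = (k)` in `(𝔸_{K⁺,f})ˣ` (`con` injective), and `exists_div_unitEmbedding_sq_eq_one` corrects `y` by `K⁺^×`.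
[cite: Milne2007FundamentalCM, §4.3 Cor. 4.15 (proof)] [cite: Omeara1963, §65C Thm. 65:15] -/
theorem exists_sq_eq_one_and_mk_finiteIdeleConorm_eq
    {y : (FiniteAdeleRing (𝓞 (maximalRealSubfield K)) (maximalRealSubfield K))ˣ}
    (hy : (QuotientGroup.mk (finiteIdeleConorm (maximalRealSubfield K) K y) :
      (FiniteAdeleRing (𝓞 K) K)ˣ ⧸ (FiniteAdeleRing.unitEmbedding (𝓞 K) K).range) ^ 2 = 1) :
    ∃ ε : (FiniteAdeleRing (𝓞 (maximalRealSubfield K)) (maximalRealSubfield K))ˣ, ε ^ 2 = 1 ∧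
      (QuotientGroup.mk (finiteIdeleConorm (maximalRealSubfield K) K ε) :
          (FiniteAdeleRing (𝓞 K) K)ˣ ⧸ (FiniteAdeleRing.unitEmbedding (𝓞 K) K).range) =
        QuotientGroup.mk (finiteIdeleConorm (maximalRealSubfield K) K y) := by
  have hy1 : (QuotientGroup.mk (finiteIdeleConorm (maximalRealSubfield K) K y ^ 2) :
      (FiniteAdeleRing (𝓞 K) K)ˣ ⧸ (FiniteAdeleRing.unitEmbedding (𝓞 K) K).range) = 1 := by
    rw [QuotientGroup.mk_pow]; exact hy
  have hy2 : finiteIdeleConorm (maximalRealSubfield K) K y ^ 2 ∈ (FiniteAdeleRing.unitEmbedding (𝓞 K) K).range :=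
    (QuotientGroup.eq_one_iff _).mp hy1
  rw [← map_pow] at hy2
  obtain ⟨k, hk⟩ := hy2
  -- `k` is fixed by `ι_K`, hence lies in `K⁺`
  have hkfix : IsCMField.complexConj K (k : K) = k := by
    have h1 : finiteIdeleConjGal K (FiniteAdeleRing.unitEmbedding (𝓞 K) K k) = FiniteAdeleRing.unitEmbedding (𝓞 K) K k := by
      rw [hk, finiteIdeleConjGal_finiteIdeleConorm]
    rw [finiteIdeleConjGal_unitEmbedding] at h1
    have h2 := congrArg (fun u : Kˣ => (u : K)) (unitEmbedding_injective K h1)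
    simpa only [Units.coe_map, MonoidHom.coe_coe] using h2
  have hkmem : (k : K) ∈ maximalRealSubfield K := (IsCMField.complexConj_eq_self_iff K (k : K)).mp hkfix
  have hk0 : (⟨(k : K), hkmem⟩ : maximalRealSubfield K) ≠ 0 := fun h0 => k.ne_zero (congrArg Subtype.val h0)
  -- `y² = (k₀)` in `(𝔸_{K⁺,f})ˣ`
  have hy2 : y ^ 2 = FiniteAdeleRing.unitEmbedding (𝓞 (maximalRealSubfield K)) (maximalRealSubfield K) (Units.mk0 _ hk0) := by
    apply finiteIdeleConorm_maximalRealSubfield_injective K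
    rw [← hk, finiteIdeleConorm_unitEmbedding]
    congr 1
    exact Units.ext rfl
  obtain ⟨b, hb⟩ := exists_div_unitEmbedding_sq_eq_one (maximalRealSubfield K) hy2
  refine ⟨y / FiniteAdeleRing.unitEmbedding (𝓞 (maximalRealSubfield K)) (maximalRealSubfield K) b, hb, ?_⟩
  rw [QuotientGroup.eq, map_div, finiteIdeleConorm_unitEmbedding, inv_div, div_mul_cancel]
  exact ⟨_, rfl⟩

end Signs

/-! ### §6. Proposition 4.14 and Corollary 4.15 for a Taniyama defect: `e_Ψ(σ) ∈ μ₂(𝔸_{f,F})/μ₂(F)` -/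

namespace IsTaniyamaDefect

variable {K : Type} [Field K] [NumberField K] [IsCMField K] {c : absoluteGaloisGroup ℚ}
  {e : Set (absoluteGaloisGroup ℚ ⧸ (absGaloisRestrict ℚ K).range) → absoluteGaloisGroup ℚ →
    (FiniteAdeleRing (𝓞 K) K)ˣ ⧸ (FiniteAdeleRing.unitEmbedding (𝓞 K) K).range}
  (he : IsTaniyamaDefect K c e) {Ψ : Set (absoluteGaloisGroup ℚ ⧸ (absGaloisRestrict ℚ K).range)} (hΨ : IsCMTypeWith c Ψ)
include he hΨ

/-- **PROPOSITION 4.14, «`e_Φ(σ) ∈ 𝔸^×_{f,F}/F^×`»**: `e_Ψ(σ) = con(y)·K^×` for a finite idèle `y` of `F = K⁺` («Thus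
`e_Φ(σ) ∈ (𝔸^×_{f,E}/E^×)^{⟨ι_E⟩}`, which equals `𝔸^×_{f,F}/F^×` by Hilbert's Theorem 90»).
[cite: Milne2007FundamentalCM, §4.3 Prop. 4.14] -/
theorem exists_eq_mk_finiteIdeleConorm (σ : absoluteGaloisGroup ℚ) :
    ∃ y : (FiniteAdeleRing (𝓞 (maximalRealSubfield K)) (maximalRealSubfield K))ˣ,
      e Ψ σ = QuotientGroup.mk (finiteIdeleConorm (maximalRealSubfield K) K y) :=
  exists_eq_mk_finiteIdeleConorm_of_finiteClassConjGal_eq K (he.finiteClassConjGal_apply hΨ σ)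

/-- **PROPOSITION 4.14 WITH COROLLARY 4.15: `e_Ψ(σ) = con(ε)·K^×` for a finite idèle `ε` of `F = K⁺` with `ε² = 1`** — a
representative `e ∈ 𝔸^×_{f,F}`, `e² = 1`, i.e. «`e_Φ(σ) ∈ μ₂(𝔸_{f,F})/μ₂(F)`» (§4.4): Prop. 4.14 gives `y` and `e_Ψ(σ)² = 1`,
and Cor. 4.15's Global-Square-Theorem step corrects `y` by an element of `F^×`.
[cite: Milne2007FundamentalCM, §4.3 Prop. 4.14, Cor. 4.15; §4.4 (first display)] -/
theorem exists_sq_eq_one_and_eq_mk_finiteIdeleConorm (σ : absoluteGaloisGroup ℚ) :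
    ∃ ε : (FiniteAdeleRing (𝓞 (maximalRealSubfield K)) (maximalRealSubfield K))ˣ, ε ^ 2 = 1 ∧
      e Ψ σ = QuotientGroup.mk (finiteIdeleConorm (maximalRealSubfield K) K ε) := by
  obtain ⟨y, hy⟩ := he.exists_eq_mk_finiteIdeleConorm hΨ σ
  have hsq := he.sq_eq_one hΨ σ
  rw [hy] at hsq
  obtain ⟨ε, hε, hεy⟩ := exists_sq_eq_one_and_mk_finiteIdeleConorm_eq K hsq
  exact ⟨ε, hε, by rw [hy, hεy]⟩

/-- **«`e = (e_v)_v`, `e_v = ±1`»**: `e_Ψ(σ)` is represented by `con(ε)` with every component `ε_v ∈ {1, -1}` (`v` a finite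
prime of `F = K⁺`). [cite: Milne2007FundamentalCM, §4.4 (first display), §4.3 Cor. 4.15] -/
theorem exists_forall_apply_eq_one_or_eq_neg_one (σ : absoluteGaloisGroup ℚ) :
    ∃ ε : (FiniteAdeleRing (𝓞 (maximalRealSubfield K)) (maximalRealSubfield K))ˣ,
      (∀ v : HeightOneSpectrum (𝓞 (maximalRealSubfield K)),
        ((ε : (FiniteAdeleRing (𝓞 (maximalRealSubfield K)) (maximalRealSubfield K))ˣ) :
            FiniteAdeleRing (𝓞 (maximalRealSubfield K)) (maximalRealSubfield K)) v = 1 ∨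
          ((ε : (FiniteAdeleRing (𝓞 (maximalRealSubfield K)) (maximalRealSubfield K))ˣ) :
            FiniteAdeleRing (𝓞 (maximalRealSubfield K)) (maximalRealSubfield K)) v = -1) ∧
      e Ψ σ = QuotientGroup.mk (finiteIdeleConorm (maximalRealSubfield K) K ε) := by
  obtain ⟨ε, hε, h⟩ := he.exists_sq_eq_one_and_eq_mk_finiteIdeleConorm hΨ σ
  exact ⟨ε, apply_eq_one_or_eq_neg_one_of_sq_eq_one (maximalRealSubfield K) hε, h⟩

end IsTaniyamaDefect

/-! ### §7. The assembled statement for an axiomatised `g_Φ` (Props. 4.13–4.14, Cor. 4.15 in one stroke) -/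

section Assembled

variable {K : Type} [Field K] [NumberField K] [IsCMField K] {φ : ℚ →+* ℝ} {c : absoluteGaloisGroup ℚ}
  (hc : IsComplexConjugation φ c)
include hc

/-- **MILNE 2007 §4.3 FOR AN AXIOMATISED `g_Φ`.**  Let `K` be a CM field, `c ∈ Γ_ℚ` a complex conjugation, and
`g = (g_Ψ(σ)) : {CM types} → Γ_ℚ → 𝔸^×_{K,f}/K^×` a family with Prop. 4.12 (a), (b) at `τ = ι`, (c) (`IsCMTypeCocycle`),
(d) `g_Ψ(σ)·ι_K g_Ψ(σ) = χ_cyc(σ)K^×`, and `g_Ψ(σ) = f_Ψ(σ)` whenever `σΨ = Ψ` (the fundamental theorem over the reflex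
field).  Then for every CM type `Ψ` and every `σ ∈ Γ_ℚ`: **`g_Ψ(σ) = f_Ψ(σ) · con(ε)·K^×` for a finite idèle `ε` of `F = K⁺`
with `ε² = 1`** (so `ε_v = ±1` at every finite prime `v` of `F`) — Theorem 4.2 (b) «becomes true when `f` is replaced by
`ef` with `e ∈ 𝔸^×_{f,F}`, `e² = 1`»; and the defect `g_Ψ(σ)/f_Ψ(σ)` depends only on `σΨ` (`IsTaniyamaDefect.eq_of_smul_set_eq`).
[cite: Milne2007FundamentalCM, §4.3 Props. 4.13, 4.14, Cor. 4.15] -/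
theorem exists_sq_eq_one_and_eq_taniyamaElement_mul
    {g : Set (absoluteGaloisGroup ℚ ⧸ (absGaloisRestrict ℚ K).range) → absoluteGaloisGroup ℚ →
      (FiniteAdeleRing (𝓞 K) K)ˣ ⧸ (FiniteAdeleRing.unitEmbedding (𝓞 K) K).range}
    (hg : IsCMTypeCocycle K c g)
    (hd : ∀ ⦃Ψ : Set (absoluteGaloisGroup ℚ ⧸ (absGaloisRestrict ℚ K).range)⦄, IsCMTypeWith c Ψ →
      ∀ σ : absoluteGaloisGroup ℚ, g Ψ σ * finiteClassConjGal K (g Ψ σ) = QuotientGroup.mk (cyclotomicFiniteIdeleIn K σ))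
    (he : ∀ ⦃Ψ : Set (absoluteGaloisGroup ℚ ⧸ (absGaloisRestrict ℚ K).range)⦄, IsCMTypeWith c Ψ →
      ∀ ⦃σ : absoluteGaloisGroup ℚ⦄, σ • Ψ = Ψ → g Ψ σ = taniyamaElement K c Ψ σ)
    {Ψ : Set (absoluteGaloisGroup ℚ ⧸ (absGaloisRestrict ℚ K).range)} (hΨ : IsCMTypeWith c Ψ) (σ : absoluteGaloisGroup ℚ) :
    ∃ ε : (FiniteAdeleRing (𝓞 (maximalRealSubfield K)) (maximalRealSubfield K))ˣ, ε ^ 2 = 1 ∧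
      g Ψ σ = taniyamaElement K c Ψ σ * QuotientGroup.mk (finiteIdeleConorm (maximalRealSubfield K) K ε) := by
  obtain ⟨ε, hε, h⟩ :=
    (isTaniyamaDefect_div_taniyamaElement hc hg hd he).exists_sq_eq_one_and_eq_mk_finiteIdeleConorm hΨ σ
  exact ⟨ε, hε, ((mul_div_cancel (taniyamaElement K c Ψ σ) (g Ψ σ)).symm.trans (by rw [h]))⟩

end Assembled

end Literature.NumberTheory.ComplexMultiplication

end
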